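import Mathlib
import HarnessLib
import Literature.Analysis.ODE.PoincareSection
import Summits.NavierStokesRegularity.NavierStokesRegularity.Theorems.TaylorModelRungThreeReadoutVLandDeriv
import Summits.NavierStokesRegularity.NavierStokesRegularity.Theorems.TaylorModelRungThreeReadoutVLandBaseWin

/-!
# Line `taylor-model` on crux K1b-DR (stmt-NavierStokesRegularity-23954) — G4-v-W: the C¹ LANDING read-out under the WINDOWED v3
# certificate, and THE CRUX FROM `ValidVW` (ns-tm-g4 g6, owner of the landing stub `LandingC1` p602189)

Port of `…ReadoutVLandDeriv` (`landingDeriv_ofV`, `kBlockLandV`, `k1bDR_of_validV`) to `ReadoutsVW` / `ValidVW`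
(`…VReadoutsWinDefs`).  The proof is the landed one (solution family of the last sub-step, transversality (R7) on the FAT box `Y¹`,
the C¹ Poincaré-map theorem, composition with the stage map and the entry segment, the landing calculus) with THREE re-pointed
reads, all justified by `crossing_windowW` (level 1): the crossing state `y` lies in the WINDOWED box `Z¹` and the relative crossing
time `sW n₀ = τ − Tn (S−1)` lies in the level-1 window `[ulo 1, uhi 1]`, so (R8w) (`y i₀ 1 ≠ 0`), (R10w) (the derivative kernel at the
crossing time) and (R11w) (the bound) apply in place of (R8)/(R10)/(R11).

* `landingDeriv_ofVW` — the derivative clause of `KBlockLand` for one stage / polytope point / tail / face;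
* `kBlockLandVW` — `KBlockLand cd φ (tauSel cd φ)` from `ValidVW` + package + «`Dsc` reads the window»;
* **`k1bDR_of_validVW`** — the crux `DerivativeEnclosureCertificateR` from `ValidVW` (+ that window fact) for the selector flow.

MODEL-lattice rung TL-M3 only; nothing here is a statement about the Navier–Stokes equations (K1b-DR is NOT proved here: that
needs an emitted certificate whose windowed Booleans evaluate to `true`, `…CertificateCloserVWin`).
-/

noncomputable section

-- the sub-problem namespace repeats the summit name by design (D-0017)
set_option linter.dupNamespace false

namespace Summit.NavierStokesRegularity.NavierStokesRegularity.Theorems.TaylorModelV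

open Set Finset Metric
open Literature.Analysis.FluidPDE.TaoCascade Literature.Analysis.FluidPDE.TaoCascade.TaylorChain
open Summit.NavierStokesRegularity.NavierStokesRegularity.Theorems.TaylorModelMajorant
open Summit.NavierStokesRegularity.NavierStokesRegularity.Theorems.TaylorModelVector
open Summit.NavierStokesRegularity.NavierStokesRegularity.Theorems.TaylorModelReadout

variable {cd : CertData} {bx : StepBoxes} {rd : RadiiData} {ro : ReadoutData} {rw : WinData} {φ : Flow}

/-! ### The C¹ landing read-out -/

section Land


/-- **THE C¹ LANDING READ-OUT (second half of `KBlockLand`)** for stage `j`, a polytope point `q`, an admissible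
tail `v` and a face `l`: along the entry segment the landing read-out is differentiable within `[0,1]` with
derivative bounded by `β j l`.  Hypotheses: the certificate predicates, `Static` (for `0 < τs`, used in `as > 0`),
and «`Dsc j` reads the window» (`hDscW`, true for the emitted diagonal scaling). [folklore] -/
theorem landingDeriv_ofVW (hSN : cd.StageNumerics) (hC : ChainVCore cd bx) (hR : ChainVRadii cd bx rd) (hF : IsFlowPackageV cd bx φ) (hRO : ReadoutsVW cd bx rd ro rw) {j : ℕ} (hj : j ≤ cd.N₀) (hSt : cd.Static) (hDscW : ∀ v, rd.Dsc j v = rd.Dsc j (trunc cd v))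
    {q : Fin 4 → ℤ → ℝ} (hq : InPoly cd j q) (v : Fin 4 → ℝ) (hv : TailOK cd v) (l : ℕ) :
    ∃ ψ : ℝ → ℝ, ∀ σ ∈ Icc (0:ℝ) 1,
      HasDerivWithinAt (fun σ' : ℝ => cd.ℓ (cd.nx j) l
        (cd.land j (stAt φ j (cd.x j 0 + σ' • (q - cd.x j 0))
          (tauSel cd φ j (cd.x j 0 + σ' • (q - cd.x j 0)))) v)) (ψ σ) (Icc 0 1) σ ∧ |ψ σ| ≤ cd.β j l := by
  -- ### data of the stage
  have hS : 1 ≤ cd.S j := (hC j hj).1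
  have hs : cd.S j - 1 < cd.S j := Nat.sub_lt hS Nat.one_pos
  have hTs := ((gridV hC hj).2.1 _ hs).2
  rw [Nat.sub_add_cancel hS] at hTs
  have hU := isUniqueFlow_of_packageV hF
  obtain ⟨-, hx0, hγ, -, hσw, -, -, -, -, -, -, -, -, hR7, hR8, -, hR10, hR11, -⟩ := hRO j hj
  have hPI := (polyInvariantV hC hR hF).1 j hj
  obtain ⟨a, haY, haX⟩ := exists_sigmaCLM hσw
  -- `as > 0`, hence crossing states have `y i₀ 1 ≠ 0`
  have has : 0 < cd.as j := by
    obtain ⟨hnx, -, -, -, hΛ, hδ, hω, -, hmar, -⟩ := hSN.1 j hj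
    have hLv : 1 ≤ cd.Lv (cd.nx j) := (hSN.1 _ hnx).2.1
    have hτs : 0 < cd.τs := hSt.2.2.2.2.2.2.2.2.2.2.2.2.1
    have h2 : 0 < (2:ℝ) ^ (-cd.θ) := Real.rpow_pos_of_pos two_pos _
    have h3 : 0 ≤ cd.Λ j * cd.δ j * cd.τs * cd.ω j 1 := by
      have := hω 1; positivity
    nlinarith
  -- ### the solution family of the last sub-step from the node states (window coordinates)
  set s₁ := cd.S j - 1 with hs₁
  set hh := cd.h j s₁ with hhh
  set Φ : (Fin (nW cd) → ℝ) → (Fin (nW cd) → ℝ) := fun x => toVec cd (stAt φ j (ofVec cd x) (cd.Tn j s₁)) with hΦ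
  set PW : Set (Fin (nW cd) → ℝ) := toVec cd '' {q | InPoly cd j q} with hPW
  set W' : Set (Fin (nW cd) → ℝ) := Φ '' PW with hW'
  set Sbox : Set (Fin (nW cd) → ℝ) := Icc (toVec cd (ro.ylo 1 j)) (toVec cd (ro.yhi 1 j)) with hSbox
  set H2 : Set (Fin (nW cd) → ℝ) := Icc (toVec cd (bx.hlo 2 j s₁)) (toVec cd (bx.hhi 2 j s₁)) with hH2
  set f : (Fin (nW cd) → ℝ) → (Fin (nW cd) → ℝ) := fun x => Qw cd x x with hf
  set u : (Fin (nW cd) → ℝ) → ℝ → (Fin (nW cd) → ℝ) := fun n t => flowSel (Qw cd) n t with hu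
  -- points of `W'` are node states of polytope trajectories
  have hW'pt : ∀ n ∈ W', ∃ q', InPoly cd j q' ∧ n = toVec cd (stAt φ j q' (cd.Tn j s₁)) := by
    rintro n ⟨x, ⟨q', hq', rfl⟩, rfl⟩
    exact ⟨q', hq', stageMap_congr hC hR hF hj hs.le hq'⟩
  have hnodeH1 : ∀ q', InPoly cd j q' → InBox cd (bx.hlo 1 j s₁) (bx.hhi 1 j s₁) (stAt φ j q' (cd.Tn j s₁)) :=
    fun q' hq' => (hPI q' hq').2 _ hs.le
  have hnodeH2 : ∀ q', InPoly cd j q' → InBox cd (bx.hlo 2 j s₁) (bx.hhi 2 j s₁) (stAt φ j q' (cd.Tn j s₁)) :=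
    fun q' hq' => inBox_hull2_of_hull1 hC hj hs.le (hnodeH1 q' hq')
  have hW'H2 : W' ⊆ H2 := by
    intro n hn; obtain ⟨q', hq', rfl⟩ := hW'pt n hn
    exact toVec_mem_Icc_of_bounds (cd := cd) (hnodeH2 q' hq')
  -- the node trajectory: `u n t = toVec (φ(node)(t)) = toVec (φ(q')(Tn s₁ + t))`, inside `Y¹`
  have hut : ∀ q', InPoly cd j q' → ∀ t, u (toVec cd (stAt φ j q' (cd.Tn j s₁))) t =
      toVec cd (stAt φ j (stAt φ j q' (cd.Tn j s₁)) t) := fun q' _ t => (toVec_stAt_eq_flowSel hF j _ t).symm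
  have huY : ∀ q', InPoly cd j q' → ∀ t ∈ Icc 0 hh,
      InBox cd (ro.ylo 1 j) (ro.yhi 1 j) (stAt φ j (stAt φ j q' (cd.Tn j s₁)) t) :=
    fun q' hq' t ht => stAt_mem_YW hSN hC hF hRO hj 1 (hnodeH1 q' hq') ht
  -- the family
  have hfam : Literature.Analysis.ODE.IsSolutionFamily f Sbox W' hh u := by
    refine ⟨fun n _ => flowSel_zero _, fun n hn t ht => ?_, fun n hn t ht => ?_⟩
    · obtain ⟨q', hq', rfl⟩ := hW'pt n hn
      obtain ⟨hsolm, -⟩ := polyNode_solves_inBox hC hF hj (hPI q' hq').1 hs (hnodeH1 q' hq')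
      have h1 := hasDerivWithinAt_toVec_stAt hsolm ht
      have e : (fun t => toVec cd (stAt φ j (stAt φ j q' (cd.Tn j s₁)) t)) =
          u (toVec cd (stAt φ j q' (cd.Tn j s₁))) := by funext t; exact (hut q' hq' t).symm
      rw [e] at h1
      rw [hut q' hq' t] 
      exact h1
    · obtain ⟨q', hq', rfl⟩ := hW'pt n hn
      rw [hut q' hq' t]
      exact toVec_mem_Icc_of_bounds (cd := cd) (huY q' hq' t ht)
  -- the field: continuous and bounded on `Sbox`
  obtain ⟨QB, hQB⟩ := exists_QwBundle cd
  obtain ⟨C, hC0, hCb⟩ := exists_norm_Q_le QB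
  have hfc : ContinuousOn f Sbox := by
    have hlip := lipschitzOnWith_quad QB hC0 hCb (R := max ‖toVec cd (ro.ylo 1 j)‖ ‖toVec cd (ro.yhi 1 j)‖)
      (le_max_of_le_left (norm_nonneg _))
    have e : (fun x => QB x x) = f := by funext x; rw [hf, hQB]
    rw [e] at hlip
    exact hlip.continuousOn.mono fun x hx => mem_closedBall_zero_iff.2 (norm_le_of_mem_Icc hx)
  obtain ⟨M, hM⟩ := isCompact_Icc.exists_bound_of_continuousOn hfc
  -- transversality along the family ((R7) on `Y¹`)
  have haf : ∀ y : Fin 4 → ℤ → ℝ, a (f (toVec cd y)) = cd.σf j (cd.Qb y y) := by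
    intro y; rw [haX, hf]; simp only; rw [ofVec_Qw_self]
  have htr : ∀ n ∈ W', ∀ t ∈ Icc 0 hh, 0 < a (f (u n t)) := by
    intro n hn t ht
    obtain ⟨q', hq', rfl⟩ := hW'pt n hn
    rw [hut q' hq' t, haf]
    exact hγ.trans_le (hR7 _ (huY q' hq' t ht))
  -- the relative crossing time on `W'`
  set sW : (Fin (nW cd) → ℝ) → ℝ := fun n => sInf {t : ℝ | 0 ≤ t ∧ t ≤ hh ∧ cd.lev j ≤ a (u n t)} with hsW
  have hsWq : ∀ q', InPoly cd j q' → sW (toVec cd (stAt φ j q' (cd.Tn j s₁))) = tauSel cd φ j q' - cd.Tn j s₁ := by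
    intro q' hq'
    obtain ⟨h1, h2, h3, h4, -, -⟩ := crossing_factsVW hSN hC hF hRO hj (hPI q' hq').1 (hPI q' hq').2
    have hval : ∀ t ∈ Icc 0 hh, a (u (toVec cd (stAt φ j q' (cd.Tn j s₁))) t) =
        cd.σf j (stAt φ j q' (cd.Tn j s₁ + t)) := by
      intro t ht; rw [hu]; simp only; rw [node_flow_eq hC hR hF hj hq' ht, ← haY]
    refine IsLeast.csInf_eq ⟨⟨by linarith, by rw [hTs] at h2; linarith, ?_⟩, ?_⟩
    · rw [hval _ ⟨by linarith, by rw [hTs] at h2; linarith⟩, add_sub_cancel, h3]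
    · rintro t ⟨ht0, hth, hlev⟩
      by_contra hlt
      have hlt' := lt_of_not_ge hlt
      rw [hval t ⟨ht0, hth⟩] at hlev
      have := h4 (cd.Tn j s₁ + t) (by linarith) (by linarith [hlt'])
      linarith
  have hsW : ∀ n ∈ W', sW n ∈ Icc 0 hh ∧ a (u n (sW n)) = cd.lev j := by
    intro n hn
    obtain ⟨q', hq', rfl⟩ := hW'pt n hn
    obtain ⟨h1, h2, h3, -, -, -⟩ := crossing_factsVW hSN hC hF hRO hj (hPI q' hq').1 (hPI q' hq').2
    have hmem : tauSel cd φ j q' - cd.Tn j s₁ ∈ Icc 0 hh := ⟨by linarith, by rw [hTs] at h2; linarith⟩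
    rw [hsWq q' hq']
    refine ⟨hmem, ?_⟩
    rw [hu]; simp only
    rw [node_flow_eq hC hR hF hj hq' hmem, ← haY, add_sub_cancel, h3]
  -- ### pointwise in σ
  suffices hpt : ∀ σ ∈ Icc (0:ℝ) 1, ∃ yv : ℝ,
      HasDerivWithinAt (fun σ' : ℝ => cd.ℓ (cd.nx j) l
        (cd.land j (stAt φ j (cd.x j 0 + σ' • (q - cd.x j 0))
          (tauSel cd φ j (cd.x j 0 + σ' • (q - cd.x j 0)))) v)) yv (Icc 0 1) σ ∧ |yv| ≤ cd.β j l by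
    classical
    refine ⟨fun σ => if hσ : σ ∈ Icc (0:ℝ) 1 then Classical.choose (hpt σ hσ) else 0, fun σ hσ => ?_⟩
    simp only [dif_pos hσ]
    exact Classical.choose_spec (hpt σ hσ)
  intro σ hσ
  set x₀ := cd.x j 0 with hx₀
  set qσ := x₀ + σ • (q - x₀) with hqσ
  have hqσP : InPoly cd j qσ := inPoly_segment hx0 hq hσ
  set n₀ := toVec cd (stAt φ j qσ (cd.Tn j s₁)) with hn₀
  have hn₀W : n₀ ∈ W' := ⟨toVec cd qσ, Set.mem_image_of_mem _ hqσP, stageMap_congr hC hR hF hj hs.le hqσP⟩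
  have hn₀H2 : InBox cd (bx.hlo 2 j s₁) (bx.hhi 2 j s₁) (stAt φ j qσ (cd.Tn j s₁)) := hnodeH2 qσ hqσP
  -- continuity in the start point, frozen-time derivative at the crossing time (F9)
  have hcont : ∀ τ' ∈ Icc 0 hh, ContinuousWithinAt (fun n => u n τ') W' n₀ := by
    intro τ' hτ'
    obtain ⟨L, hL, -, -⟩ := exists_fderiv_directional_of_core hSN hC hj hs hn₀H2 hτ'
    exact (hL.continuousWithinAt).mono hW'H2
  obtain ⟨hs0, hlev0⟩ := hsW n₀ hn₀W
  obtain ⟨J, A, hJ, hAker, hJA⟩ := exists_inStepKerAt hSN hC hj hs hn₀H2 hs0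
  obtain ⟨-, hDP⟩ := Literature.Analysis.ODE.hasFDerivWithinAt_crossingTime_poincareMap hfam hM hfc htr hsW hn₀W
    hcont (hJ.mono hW'H2)
  -- ### composition with the stage map and the segment
  obtain ⟨LΦ, KΦ, hLΦ, hKΦ, hLK⟩ := polyDerivV hC hR hF hj hSN s₁ hs.le qσ hqσP
  have eΦ : Φ (toVec cd qσ) = n₀ := stageMap_congr hC hR hF hj hs.le hqσP
  rw [← eΦ] at hDP
  have hcomp := hDP.comp (toVec cd qσ) hLΦ (Set.mapsTo_image Φ PW)
  -- the segment in window coordinates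
  have hγ : HasDerivWithinAt (fun σ' : ℝ => toVec cd (x₀ + σ' • (q - x₀))) (toVec cd (q - x₀)) (Icc 0 1) σ := by
    have h1 := ((hasDerivWithinAt_id σ (Icc (0:ℝ) 1)).smul_const (toVec cd (q - x₀))).const_add (toVec cd x₀)
    rw [one_smul] at h1
    exact h1
  have hγmaps : MapsTo (fun σ' : ℝ => toVec cd (x₀ + σ' • (q - x₀))) (Icc (0:ℝ) 1) PW :=
    fun σ' hσ' => Set.mem_image_of_mem _ (inPoly_segment hx0 hq hσ')
  have hPγ := hcomp.comp_hasDerivWithinAt σ hγ hγmaps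
  -- identification of the composite with the crossing state along the segment
  have hident : ∀ σ' ∈ Icc (0:ℝ) 1,
      ((fun n => u n (sW n)) ∘ Φ) (toVec cd (x₀ + σ' • (q - x₀))) =
        toVec cd (stAt φ j (x₀ + σ' • (q - x₀)) (tauSel cd φ j (x₀ + σ' • (q - x₀)))) := by
    intro σ' hσ'
    have hq' : InPoly cd j (x₀ + σ' • (q - x₀)) := inPoly_segment hx0 hq hσ'
    have eΦ' : Φ (toVec cd (x₀ + σ' • (q - x₀))) = toVec cd (stAt φ j (x₀ + σ' • (q - x₀)) (cd.Tn j s₁)) :=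
      stageMap_congr hC hR hF hj hs.le hq'
    simp only [Function.comp]
    rw [eΦ', hsWq _ hq']
    obtain ⟨h1, h2, -, -, -, -⟩ := crossing_factsVW hSN hC hF hRO hj (hPI _ hq').1 (hPI _ hq').2
    rw [hu]; simp only
    rw [node_flow_eq hC hR hF hj hq' ⟨by linarith, by rw [hTs] at h2; linarith⟩, add_sub_cancel]
  have hp : HasDerivWithinAt
      (fun σ' : ℝ => toVec cd (stAt φ j (x₀ + σ' • (q - x₀)) (tauSel cd φ j (x₀ + σ' • (q - x₀)))))
      (((J - (a (f (u (Φ (toVec cd qσ)) (sW (Φ (toVec cd qσ))))))⁻¹ •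
          (a.comp J).smulRight (f (u (Φ (toVec cd qσ)) (sW (Φ (toVec cd qσ)))))).comp LΦ) (toVec cd (q - x₀)))
      (Icc 0 1) σ :=
    hPγ.congr_of_mem (fun σ' hσ' => (hident σ' hσ').symm) hσ
  -- the crossing state and its read-out data
  set y := stAt φ j qσ (tauSel cd φ j qσ) with hy
  obtain ⟨-, -, hσy, -, -, -⟩ := crossing_factsVW hSN hC hF hRO hj (hPI qσ hqσP).1 (hPI qσ hqσP).2
  -- NEW (windowed): the crossing time lies in the level-1 window and the crossing state in `Z¹`
  obtain ⟨hwlo, hwhi, hyZ⟩ := crossing_windowW hSN hC hF hRO hj (hPI qσ hqσP).1 (hPI qσ hqσP).2 1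
    (by simpa [hullLevel] using (hPI qσ hqσP).2 _ hs.le)
  have hsw : sW n₀ ∈ Icc (rw.ulo 1 j) (rw.uhi 1 j) := by
    rw [hn₀, hsWq qσ hqσP]; exact ⟨by linarith, by linarith⟩
  have hp0 : u (Φ (toVec cd qσ)) (sW (Φ (toVec cd qσ))) = toVec cd y := by
    have h := hident σ hσ; simp only [Function.comp] at h; exact h
  have hy0 : ofVec cd (toVec cd y) cd.i₀ 1 ≠ 0 := by
    rw [ofVec_toVec_of_wsupp cd (wsupp_stAtU hU hj _ _)]
    have h1 := (hR8 _ hyZ hσy).1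
    intro h0; rw [h0, abs_zero] at h1; linarith
  -- ### the landing calculus
  have hland := G2.hasDerivWithinAt_ell_land cd j (cd.nx j) l v hp hy0
  refine ⟨_, hland.congr_of_mem (fun σ' _ => ?_) hσ, ?_⟩
  · -- same function (`ofVec ∘ toVec` of a window-supported state)
    rw [ofVec_toVec_of_wsupp cd (wsupp_stAtU hU hj _ _)]
  · -- ### the bound: the direction is `secCorr y (kapp V ζ)` with the (R10)-kernel `V`
    rw [ofVec_toVec_of_wsupp cd (wsupp_stAtU hU hj _ _), hp0]
    -- the polytope parameter of `q` and the direction `toVec (q − x₀) = toVec (Dsc ζ)`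
    obtain ⟨-, -, -, hENTRY, -⟩ := hR j hj
    obtain ⟨ζ, -, hqζ⟩ := hENTRY q hq
    have hdir : toVec cd (q - x₀) = toVec cd (rd.Dsc j (trunc cd ζ)) := by
      funext c
      rw [← hDscW]
      simp only [toVec, Pi.sub_apply]
      have := hqζ (modeOf cd c) (shellOf cd c) (shellOf_mem cd c).1 (shellOf_mem cd c).2
      rw [this]
      simp only [hx₀, Pi.add_apply]; ring
    -- the (R10)-kernel
    obtain ⟨Wk, hWk, hKW⟩ := hKΦ
    set V : Ker := kerOf fun w => kapp cd A (rd.Vc j s₁ w + cd.Cm j s₁ (kapp cd Wk w)) with hV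
    have hVmem : KerMem cd V (ro.Vlo j) (ro.Vhi j) := hR10 _ hsw A hAker Wk hWk
    -- linearity of the map behind `V`
    obtain ⟨hVclin, -, -, -⟩ := (hR j hj).2.2.2.2.2.2.1 s₁ hs.le
    obtain ⟨-, -, hCmlin, -⟩ := (hC j hj).2.2.1 s₁ hs.le
    have hlinV : IsLinearMap ℝ fun w => kapp cd A (rd.Vc j s₁ w + cd.Cm j s₁ (kapp cd Wk w)) := by
      constructor
      · intro w w'
        rw [hVclin.map_add, (kapp_linear Wk).map_add, hCmlin.map_add, ← (kapp_linear A).map_add]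
        congr 1; abel
      · intro r w
        rw [hVclin.map_smul, (kapp_linear Wk).map_smul, hCmlin.map_smul, ← smul_add, (kapp_linear A).map_smul]
    -- `ofVec (J w) = kapp V ζ`
    set w := LΦ (toVec cd (q - x₀)) with hw
    have hwK : ∀ i k, -cd.Kb ≤ k → k ≤ cd.Ka → ofVec cd w i k = kapp cd KΦ (trunc cd ζ) i k := by
      intro i k hk1 hk2
      rw [ofVec_apply_of_mem cd w i ⟨hk1, hk2⟩, hw, hdir]
      exact hLK _ (wsupp_trunc cd ζ) i k ⟨hk1, hk2⟩
    have hJw : ofVec cd (J w) = kapp cd V ζ := by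
      refine eq_of_wsupp_of_window (wsupp_ofVec cd _) (wsupp_kapp _ _) fun i' k' hk1' hk2' => ?_
      rw [ofVec_apply_of_mem cd _ i' ⟨hk1', hk2'⟩, hJA w i' k' ⟨hk1', hk2'⟩,
        kapp_congr V (w := trunc cd ζ) (fun i k hk1 hk2 => by rw [trunc_apply, if_pos ⟨hk1, hk2⟩]),
        hV, kapp_kerOf hlinV (wsupp_trunc cd ζ) i' ⟨hk1', hk2'⟩, ← hKW _ (wsupp_trunc cd ζ)]
      exact congrFun (congrFun (kapp_congr A hwK) i') k'
    -- the direction of the composite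
    have hval : ofVec cd (((J - (a (f (toVec cd y)))⁻¹ • (a.comp J).smulRight (f (toVec cd y))).comp LΦ)
        (toVec cd (q - x₀))) = secCorr cd j y (kapp cd V ζ) := by
      have e1 : ((J - (a (f (toVec cd y)))⁻¹ • (a.comp J).smulRight (f (toVec cd y))).comp LΦ) (toVec cd (q - x₀))
          = J w - (a (f (toVec cd y)))⁻¹ • ((a (J w)) • f (toVec cd y)) := by
        simp only [ContinuousLinearMap.coe_comp, Function.comp_apply, FunLike.coe_sub, Pi.sub_apply,
          FunLike.coe_smul, Pi.smul_apply, ContinuousLinearMap.smulRight_apply, ← hw]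
      rw [e1, ofVec_sub, ofVec_smul, ofVec_smul, haf, haX (J w), hJw]
      have e2 : ofVec cd (f (toVec cd y)) = cd.Qb y y := by simp only [hf]; exact ofVec_Qw_self y
      rw [e2, secCorr, smul_smul, inv_mul_eq_div]
    rw [hval]
    exact hR11 y hyZ hσy V hVmem q ζ hq hqζ v hv l

end Land

/-! ### The landing block and the crux from `ValidVW` -/

/-- **`KBlockLand` from the v3 certificate** (crossing time `tauSel`), given a flow package and «`Dsc` reads the
window». [folklore] -/
theorem kBlockLandVW (hV : ValidVW cd bx rd ro rw) (hF : IsFlowPackageV cd bx φ)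
    (hDscW : ∀ j, j ≤ cd.N₀ → ∀ v, rd.Dsc j v = rd.Dsc j (trunc cd v)) : KBlockLand cd φ (tauSel cd φ) := by
  obtain ⟨hSt, hSN, ⟨hC, hR⟩, hRO⟩ := hV
  intro j hj
  obtain ⟨hx0, hbase⟩ := baseLanding_ofVW hSN hC hR hF hRO hj
  refine ⟨hx0, fun v hv l => ⟨hbase v hv l, fun q hq => ?_⟩⟩
  exact landingDeriv_ofVW hSN hC hR hF hRO hj hSt (hDscW j hj) hq v hv l

/-- **K1b-DR (`DerivativeEnclosureCertificateR`) from a v3 certificate** `ValidV cd bx rd ro` whose stage scalings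
read the window — the selector flow of S1 is the witness flow (`isFlowPackageV_of_core`), the crossing time is
`tauSel`, and the four blocks are G1-v–G4-v of this line.  (The existence of such a certificate is the K-side's
`native_decide` replay; nothing about it is asserted here.) [folklore] -/
theorem k1bDR_of_validVW (hV : ValidVW cd bx rd ro rw)
    (hDscW : ∀ j, j ≤ cd.N₀ → ∀ v, rd.Dsc j v = rd.Dsc j (trunc cd v)) :
    Summit.NavierStokesRegularity.NavierStokesRegularity.Theses.ExactWindowRungThree.DerivativeEnclosureCertificateR :=
  k1bDR_of_validVW_of_land hV (kBlockLandVW hV (isFlowPackageV_of_core hV.2.1 hV.2.2.1.1) hDscW)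

end Summit.NavierStokesRegularity.NavierStokesRegularity.Theorems.TaylorModelV

end
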